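/-
Origin: expansion seat `planner-pub-hodgecm-mc-sanity-1-0`, handover #4 2026-08-18T19:05Z md5 c6a0ae6b4cb48176078d7b87012c35c3 (NEW additive leaf, 232 l.; imports HodgeCM.Model.Sanity.KernelsLoadBearing (row 5) + HodgeCM.Model.EndStatePerLAxioms = prl1-g11 E2′ RUN-32 row (src 5e4b37d80c3c) as targeted, no rewrite; land with/after E2′ — if E2′ slips hold this ONE file) (`HOME/mc/pub-hodgecm-mc-sanity-1/lean/PointwiseSanity.lean`, md5 c6a0ae6b, 232 lines);
landed by the packager successor (mc-unitary-1-g3, gen-8 kit) in gate run 32 as `HodgeCM/Model/Sanity/PointwiseSanity.lean` (verbatim).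
-/
/-
HodgeCM / MODEL-CONSTRUCTION sub-cell (pub-hodgecm), node SAN — construction prover `pub-hodgecm-mc-sanity-1`
(seat planner-pub-hodgecm-mc-sanity-1-0), 2026-08-18.  Intended PKG path: `HodgeCM/Model/Sanity/PointwiseSanity.lean`.
Imports `Sanity/KernelsLoadBearing.lean` (this seat) and E2′ = `HodgeCM/Model/EndStatePerLAxioms.lean` (prl1-g11,
RUN-32 row, md5 5e4b37d80c3c); nothing restated, no new axioms, no hypotheses records, 0 proof holes.
-/
import Summits.HodgeConjecture.HodgeCM.Model.Sanity.KernelsLoadBearing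
import Summits.HodgeConjecture.HodgeCM.Model.EndStatePerLAxioms_2

/-!
# Sanity at the POINTWISE end state (ruling J-SAN″): degenerate kernels have no local E2′ witness, at any context

Ruling J-SAN″ (carvers, 18:55:57Z) makes the E2 interface POINTWISE: the assembly feeds, AT each PerL context `(V, c)`,
the local bodies `h₁ h₂ h₅ … h₁₀` of `ModelAxiomsPerL.nonempty_thetaRealisation_at` (E2′) for `T := C.thetaModel h d12 d34`.
This file is the pointwise form of `Sanity/KernelsLoadBearing.lean` (referee rule R2), over the FIVE PerL model facts
`M : U.ModelAxiomsPerL` instead of the 28: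

* `ZeroKernelsAt C V c` — the adelic Weil theta model of the core at `(V, c)` has all kernels `θ_Φ = 0`
  (`C.ZeroKernels ↔ ∀ V c, C.ZeroKernelsAt V c`, `Iff.rfl`).
* POSITIVE (vacuity) rows: at such a context the local bodies `h₈` (reality of `ϑ_{T',χ}`) and `h₁₀` (occurrence) of
  E2′ HOLD outright (`real34At_of_zeroKernelsAt`, `occAt_of_zeroKernelsAt`), and `h₇` (either target: `S₁₂` or
  `S₁₂^all`) is EQUIVALENT to "`emb Γ` kills every theta wedge `ω₁ ∪ ω₂`, `ωᵢ ∈ Θᵢ(Γ)`" (`S12_eq_bot_at`,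
  `gen12At_iff_of_zeroKernelsAt`).
* NO-GO (`false_of_zeroKernelsAt`): `M : U.ModelAxiomsPerL`, `hHR : U.Fact_hodgeRiemann20`, zero kernels at `(V,c)`,
  and the local bodies `h₂` (C2 at the levels of `V`), `h₅` (`Θᵢ ⊆ U_iso`), `h₆` (a nonzero theta wedge), `h₇` ⊢ `False`.
  So every accepted pointwise witness has a NONZERO theta kernel AT the PerL context itself — the `wm` slot is
  load-bearing context by context; in particular `withDegenerateWM` is refuted at every context
  (`false_withDegenerateWM_at`), and so is the J1 junction core `withAdelicDegenerateWM` of `Sanity/JunctionSanity.lean`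
  (honest adelic groups, `θ := 0`) by the same one-liner with `withAdelicDegenerateWM_zeroKernels V c`.
* `not_h6_of_emptyThetaAt`: with `Θᵢ(Γ) = ∅` at the context, `h₆` fails (and `h₅`, `h₇` hold vacuously).
-/

set_option autoImplicit false

noncomputable section

open HodgeCM HodgeCM.Universe
open scoped InnerProductSpace
open Literature.AlgebraicGeometry.Motives (HodgeStructure)
open Literature.AlgebraicGeometry.Motives.HodgeStructure (conj)

attribute [-instance] Quotient.instMeasurableSpace

namespace HodgeCM

namespace Universe.AdelicThetaCore

variable {U : Universe} {hP : PrintFact_unitaryCompact} (C : U.AdelicThetaCore hP) (h : Bool)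
variable (d12 d34 : ∀ {L : CMField}, SeesawCtx L → SideData L)

/-- **Zero theta kernels AT the context `(V, c)`.** -/
def ZeroKernelsAt {L : CMField} {ι₁ : L →+* ℂ} (V : HermSpace3 L ι₁) (c : SeesawCtx L) : Prop :=
  ∀ Φ : (C.wm V c).SK, (C.wm V c).θ Φ = 0

/-- (Ported verbatim from the HodgeCMPerL package; no docstring in the source.) -/
theorem zeroKernels_iff_forall_at :
    C.ZeroKernels ↔ ∀ {L : CMField} {ι₁ : L →+* ℂ} (V : HermSpace3 L ι₁) (c : SeesawCtx L), C.ZeroKernelsAt V c :=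
  Iff.rfl

/-- (Ported verbatim from the HodgeCMPerL package; no docstring in the source.) -/
theorem withDegenerateWM_zeroKernelsAt {L : CMField} {ι₁ : L →+* ℂ} (V : HermSpace3 L ι₁) (c : SeesawCtx L) :
    C.withDegenerateWM.ZeroKernelsAt V c :=
  C.withDegenerateWM_zeroKernels V c

/-- **Empty theta sets AT the context.** -/
def EmptyThetaAt {L : CMField} {ι₁ : L →+* ℂ} (V : HermSpace3 L ι₁) (c : SeesawCtx L) : Prop :=
  ∀ (i : Fin 4) (Γ : Level V), C.Theta V c i Γ = ∅

section At

variable {C}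
variable {L : CMField} {ι₁ : L →+* ℂ} {V : HermSpace3 L ι₁} {c : SeesawCtx L}

/-- Zero kernels at `(V,c)` ⇒ the closed span of ALL `ϑ_{T,χ}(Φ)` (side 12) is `{0}`. -/
theorem span_ϑ12_eq_bot_at (hθ : C.ZeroKernelsAt V c) :
    (Submodule.span ℂ {u : (C.thetaModel h d12 d34).HG L ι₁ V |
        ∃ (χ : ((C.thetaModel h d12 d34).t12 V c).X) (Φ : (C.thetaModel h d12 d34).SK V c),
          u = ((C.thetaModel h d12 d34).t12 V c).ϑ χ Φ}).topologicalClosure = ⊥ := by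
  have hle : Submodule.span ℂ {u : (C.thetaModel h d12 d34).HG L ι₁ V |
      ∃ (χ : ((C.thetaModel h d12 d34).t12 V c).X) (Φ : (C.thetaModel h d12 d34).SK V c),
        u = ((C.thetaModel h d12 d34).t12 V c).ϑ χ Φ} ≤ ⊥ := by
    refine Submodule.span_le.mpr ?_
    rintro u ⟨χ, Φ, rfl⟩
    rw [SetLike.mem_coe, Submodule.mem_bot]
    exact C.thetaModel_ϑ12_eq_zero h d12 d34 V c hθ χ Φ
  refine le_bot_iff.mp (Submodule.topologicalClosure_minimal _ hle ?_)
  rw [Submodule.bot_coe]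
  exact isClosed_singleton

/-- Zero kernels at `(V,c)` ⇒ `S₁₂ = {0}` (the allowed-pair target of E2′'s `h₇`). -/
theorem S12_eq_bot_at (hθ : C.ZeroKernelsAt V c) : ((C.thetaModel h d12 d34).t12 V c).S12 = ⊥ := by
  refine le_bot_iff.mp (((C.thetaModel h d12 d34).t12 V c).S12_le_allChars.trans ?_)
  rw [((C.thetaModel h d12 d34).t12 V c).allChars_S12, span_ϑ12_eq_bot_at h d12 d34 hθ]

/-- **`h₈` of E2′ HOLDS at a zero-kernel context** (`ϑ_{T',χ}(Φ) = 0` lies in every closed span). -/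
theorem real34At_of_zeroKernelsAt (hθ : C.ZeroKernelsAt V c) :
    ∀ (χ : ((C.thetaModel h d12 d34).t34 V c).X) (Φ : (C.thetaModel h d12 d34).SK V c),
      ((C.thetaModel h d12 d34).t34 V c).ϑ χ Φ ∈
        (Submodule.span ℂ ((C.thetaModel h d12 d34).wedgeSet V c 2 3)).topologicalClosure := by
  intro χ Φ
  rw [C.thetaModel_ϑ34_eq_zero h d12 d34 V c hθ χ Φ]
  exact Submodule.zero_mem _

/-- **`h₁₀` of E2′ HOLDS at a zero-kernel context** (`T_Φ = 0`, so the occurrence premiss is never met). -/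
theorem occAt_of_zeroKernelsAt (hθ : C.ZeroKernelsAt V c) :
    (∀ (Φ : (C.thetaModel h d12 d34).SK V c) (i : (C.thetaModel h d12 d34).SigIdx V c),
        (∃ v ∈ ((C.thetaModel h d12 d34).core V c).hatσ i, ((C.thetaModel h d12 d34).core V c).TΦ Φ v ≠ 0) →
          ((C.thetaModel h d12 d34).t12 V c).wOccurs i) ∧
      (∀ (Φ : (C.thetaModel h d12 d34).SK V c) (i : (C.thetaModel h d12 d34).SigIdx V c),
        (∃ v ∈ ((C.thetaModel h d12 d34).core V c).hatσ i, ((C.thetaModel h d12 d34).core V c).TΦ Φ v ≠ 0) →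
          ((C.thetaModel h d12 d34).t34 V c).wOccurs i) := by
  refine ⟨fun Φ i hv => ?_, fun Φ i hv => ?_⟩ <;>
  · obtain ⟨v, -, hv⟩ := hv
    exact (hv (C.thetaModel_TΦ_eq_zero h d12 d34 V c hθ Φ v)).elim

/-- **`h₇` (target `S₁₂^all`) at a zero-kernel context ⟺ `emb` kills every theta wedge of the context.** -/
theorem gen12AllAt_iff_of_zeroKernelsAt (hθ : C.ZeroKernelsAt V c) :
    (∀ (Γ : Level V) (ω₁ ω₂ : U.CohC (U.pms L ι₁ V Γ) 1), ω₁ ∈ (C.thetaModel h d12 d34).Theta V c 0 Γ →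
        ω₂ ∈ (C.thetaModel h d12 d34).Theta V c 1 Γ →
        (C.thetaModel h d12 d34).Λ Γ ω₁ ω₂ ∈ (Submodule.span ℂ
          {u : (C.thetaModel h d12 d34).HG L ι₁ V | ∃ (χ : ((C.thetaModel h d12 d34).t12 V c).X)
            (Φ : (C.thetaModel h d12 d34).SK V c), u = ((C.thetaModel h d12 d34).t12 V c).ϑ χ Φ}).topologicalClosure) ↔
      ∀ (Γ : Level V) (ω₁ ω₂ : U.CohC (U.pms L ι₁ V Γ) 1), ω₁ ∈ C.Theta V c 0 Γ → ω₂ ∈ C.Theta V c 1 Γ →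
        C.emb Γ (U.cup2C (U.pms L ι₁ V Γ) 1 ω₁ ω₂) = 0 := by
  constructor
  · intro H Γ ω₁ ω₂ h₁ h₂
    have hmem := H Γ ω₁ ω₂ h₁ h₂
    rw [span_ϑ12_eq_bot_at h d12 d34 hθ, Submodule.mem_bot] at hmem
    exact hmem
  · intro H Γ ω₁ ω₂ h₁ h₂
    have h0 : (C.thetaModel h d12 d34).Λ Γ ω₁ ω₂ = 0 := H Γ ω₁ ω₂ h₁ h₂
    rw [h0]
    exact Submodule.zero_mem _

/-- **`h₇` (target `S₁₂`) at a zero-kernel context ⟺ `emb` kills every theta wedge of the context.** -/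
theorem gen12At_iff_of_zeroKernelsAt (hθ : C.ZeroKernelsAt V c) :
    (∀ (Γ : Level V) (ω₁ ω₂ : U.CohC (U.pms L ι₁ V Γ) 1), ω₁ ∈ (C.thetaModel h d12 d34).Theta V c 0 Γ →
        ω₂ ∈ (C.thetaModel h d12 d34).Theta V c 1 Γ →
        (C.thetaModel h d12 d34).Λ Γ ω₁ ω₂ ∈ ((C.thetaModel h d12 d34).t12 V c).S12) ↔
      ∀ (Γ : Level V) (ω₁ ω₂ : U.CohC (U.pms L ι₁ V Γ) 1), ω₁ ∈ C.Theta V c 0 Γ → ω₂ ∈ C.Theta V c 1 Γ →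
        C.emb Γ (U.cup2C (U.pms L ι₁ V Γ) 1 ω₁ ω₂) = 0 := by
  rw [S12_eq_bot_at h d12 d34 hθ]
  constructor
  · intro H Γ ω₁ ω₂ h₁ h₂
    exact (Submodule.mem_bot ℂ).mp (H Γ ω₁ ω₂ h₁ h₂)
  · intro H Γ ω₁ ω₂ h₁ h₂
    exact (Submodule.mem_bot ℂ).mpr (H Γ ω₁ ω₂ h₁ h₂)

/-- **NO-GO at the pointwise end state.**  Over the five PerL model facts and HR(2,0): zero kernels at `(V, c)` are
incompatible with the local bodies `h₂` (C2 at the levels of `V`), `h₅`, `h₆`, `h₇` (target `S₁₂^all`) of E2′. -/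
theorem false_of_zeroKernelsAt (M : U.ModelAxiomsPerL) (hHR : U.Fact_hodgeRiemann20) (hθ : C.ZeroKernelsAt V c)
    (h₂ : ∀ Γ : Level V, ∃ a : ℂ, a ≠ 0 ∧ ∀ η η' : U.CohC (U.pms L ι₁ V Γ) 2,
      η ∈ (U.hodge (U.pms L ι₁ V Γ) 2).F 2 → η' ∈ (U.hodge (U.pms L ι₁ V Γ) 2).F 2 →
      ⟪(C.thetaModel h d12 d34).emb Γ η', (C.thetaModel h d12 d34).emb Γ η⟫_ℂ =
        a * U.trC (U.pms L ι₁ V Γ) 4 (U.cup2C (U.pms L ι₁ V Γ) 2 η (conj η')))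
    (h₅ : ∀ (i : Fin 4) (Γ : Level V), (C.thetaModel h d12 d34).Theta V c i Γ ⊆ U.Uiso Γ c.K (c.Ψ i) c.σ)
    (h₆ : ∃ Γ : Level V, ∃ ω₁ ∈ (C.thetaModel h d12 d34).Theta V c 0 Γ, ∃ ω₂ ∈ (C.thetaModel h d12 d34).Theta V c 1 Γ,
      U.cup2C (U.pms L ι₁ V Γ) 1 ω₁ ω₂ ≠ 0)
    (h₇ : ∀ (Γ : Level V) (ω₁ ω₂ : U.CohC (U.pms L ι₁ V Γ) 1), ω₁ ∈ (C.thetaModel h d12 d34).Theta V c 0 Γ →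
        ω₂ ∈ (C.thetaModel h d12 d34).Theta V c 1 Γ →
        (C.thetaModel h d12 d34).Λ Γ ω₁ ω₂ ∈ (Submodule.span ℂ
          {u : (C.thetaModel h d12 d34).HG L ι₁ V | ∃ (χ : ((C.thetaModel h d12 d34).t12 V c).X)
            (Φ : (C.thetaModel h d12 d34).SK V c), u = ((C.thetaModel h d12 d34).t12 V c).ϑ χ Φ}).topologicalClosure) :
    False := by
  obtain ⟨Γ, ω₁, e₁, ω₂, e₂, hne⟩ := h₆
  have hH10 : ∀ (i : Fin 4), ∀ ω ∈ (C.thetaModel h d12 d34).Theta V c i Γ, ω ∈ U.H10 (U.pms L ι₁ V Γ) :=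
    fun i ω hω => U.Uiso_le_H10 M.pull_hodge Γ c.K (c.Ψ i) c.σ (h₅ i Γ hω)
  have hF2 := ModelAxiomsPerL.cup2C_mem_F2 M _ (hH10 0 ω₁ e₁) (hH10 1 ω₂ e₂)
  have hne' := ModelAxiomsPerL.emb_ne_zero_at M (C.thetaModel h d12 d34) Γ (h₂ Γ) hHR hF2 hne
  exact hne' ((gen12AllAt_iff_of_zeroKernelsAt h d12 d34 hθ).mp h₇ Γ ω₁ ω₂ e₁ e₂)

/-- Same NO-GO with `h₇` targeting the allowed-pair space `S₁₂` (E2′ `nonempty_thetaRealisation_at`). -/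
theorem false_of_zeroKernelsAt' (M : U.ModelAxiomsPerL) (hHR : U.Fact_hodgeRiemann20) (hθ : C.ZeroKernelsAt V c)
    (h₂ : ∀ Γ : Level V, ∃ a : ℂ, a ≠ 0 ∧ ∀ η η' : U.CohC (U.pms L ι₁ V Γ) 2,
      η ∈ (U.hodge (U.pms L ι₁ V Γ) 2).F 2 → η' ∈ (U.hodge (U.pms L ι₁ V Γ) 2).F 2 →
      ⟪(C.thetaModel h d12 d34).emb Γ η', (C.thetaModel h d12 d34).emb Γ η⟫_ℂ =
        a * U.trC (U.pms L ι₁ V Γ) 4 (U.cup2C (U.pms L ι₁ V Γ) 2 η (conj η')))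
    (h₅ : ∀ (i : Fin 4) (Γ : Level V), (C.thetaModel h d12 d34).Theta V c i Γ ⊆ U.Uiso Γ c.K (c.Ψ i) c.σ)
    (h₆ : ∃ Γ : Level V, ∃ ω₁ ∈ (C.thetaModel h d12 d34).Theta V c 0 Γ, ∃ ω₂ ∈ (C.thetaModel h d12 d34).Theta V c 1 Γ,
      U.cup2C (U.pms L ι₁ V Γ) 1 ω₁ ω₂ ≠ 0)
    (h₇ : ∀ (Γ : Level V) (ω₁ ω₂ : U.CohC (U.pms L ι₁ V Γ) 1), ω₁ ∈ (C.thetaModel h d12 d34).Theta V c 0 Γ →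
        ω₂ ∈ (C.thetaModel h d12 d34).Theta V c 1 Γ →
        (C.thetaModel h d12 d34).Λ Γ ω₁ ω₂ ∈ ((C.thetaModel h d12 d34).t12 V c).S12) :
    False :=
  false_of_zeroKernelsAt h d12 d34 M hHR hθ h₂ h₅ h₆ fun Γ ω₁ ω₂ e₁ e₂ =>
    ((C.thetaModel h d12 d34).t12 V c).allChars_S12 ▸
      ((C.thetaModel h d12 d34).t12 V c).S12_le_allChars (h₇ Γ ω₁ ω₂ e₁ e₂)

/-- **Empty theta sets at the context refute `h₆`** (while `h₅`, `h₇` hold vacuously). -/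
theorem not_h6_of_emptyThetaAt (hΘ : C.EmptyThetaAt V c) :
    ¬ ∃ Γ : Level V, ∃ ω₁ ∈ (C.thetaModel h d12 d34).Theta V c 0 Γ, ∃ ω₂ ∈ (C.thetaModel h d12 d34).Theta V c 1 Γ,
      U.cup2C (U.pms L ι₁ V Γ) 1 ω₁ ω₂ ≠ 0 := by
  rintro ⟨Γ, ω₁, e₁, -⟩
  rw [C.thetaModel_Theta h d12 d34 V c 0 Γ, hΘ 0 Γ] at e₁
  exact (Set.mem_empty_iff_false ω₁).mp e₁

/-- (Ported verbatim from the HodgeCMPerL package; no docstring in the source.) -/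
theorem h5_of_emptyThetaAt (hΘ : C.EmptyThetaAt V c) :
    ∀ (i : Fin 4) (Γ : Level V), (C.thetaModel h d12 d34).Theta V c i Γ ⊆ U.Uiso Γ c.K (c.Ψ i) c.σ := by
  intro i Γ ω hω
  rw [C.thetaModel_Theta h d12 d34 V c i Γ, hΘ i Γ] at hω
  exact ((Set.mem_empty_iff_false ω).mp hω).elim

end At

/-! ## The degenerate core is refuted AT EVERY CONTEXT -/

section Cores

variable {L : CMField} {ι₁ : L →+* ℂ} (V : HermSpace3 L ι₁) (c : SeesawCtx L)

/-- `withDegenerateWM` (kernels `θ := 0` on the trivial groups) has no pointwise E2′ witness at `(V, c)`. -/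
theorem false_withDegenerateWM_at (M : U.ModelAxiomsPerL) (hHR : U.Fact_hodgeRiemann20)
    (h₂ : ∀ Γ : Level V, ∃ a : ℂ, a ≠ 0 ∧ ∀ η η' : U.CohC (U.pms L ι₁ V Γ) 2,
      η ∈ (U.hodge (U.pms L ι₁ V Γ) 2).F 2 → η' ∈ (U.hodge (U.pms L ι₁ V Γ) 2).F 2 →
      ⟪(C.withDegenerateWM.thetaModel h d12 d34).emb Γ η', (C.withDegenerateWM.thetaModel h d12 d34).emb Γ η⟫_ℂ =
        a * U.trC (U.pms L ι₁ V Γ) 4 (U.cup2C (U.pms L ι₁ V Γ) 2 η (conj η')))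
    (h₅ : ∀ (i : Fin 4) (Γ : Level V),
      (C.withDegenerateWM.thetaModel h d12 d34).Theta V c i Γ ⊆ U.Uiso Γ c.K (c.Ψ i) c.σ)
    (h₆ : ∃ Γ : Level V, ∃ ω₁ ∈ (C.withDegenerateWM.thetaModel h d12 d34).Theta V c 0 Γ,
      ∃ ω₂ ∈ (C.withDegenerateWM.thetaModel h d12 d34).Theta V c 1 Γ, U.cup2C (U.pms L ι₁ V Γ) 1 ω₁ ω₂ ≠ 0)
    (h₇ : ∀ (Γ : Level V) (ω₁ ω₂ : U.CohC (U.pms L ι₁ V Γ) 1),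
        ω₁ ∈ (C.withDegenerateWM.thetaModel h d12 d34).Theta V c 0 Γ →
        ω₂ ∈ (C.withDegenerateWM.thetaModel h d12 d34).Theta V c 1 Γ →
        (C.withDegenerateWM.thetaModel h d12 d34).Λ Γ ω₁ ω₂ ∈
          ((C.withDegenerateWM.thetaModel h d12 d34).t12 V c).S12) : False :=
  false_of_zeroKernelsAt' h d12 d34 M hHR (C.withDegenerateWM_zeroKernelsAt V c) h₂ h₅ h₆ h₇

end Cores

end Universe.AdelicThetaCore

end HodgeCM

end
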